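import Literature.Probability.LatticeModels.BoxDirichlet
import HarnessLib

/-!
# Summation by parts, Dirichlet energy and the `L¹` gradient bound for bounded subharmonic functions

Topic `Literature/Probability/LatticeModels`; an instalment (items P3–P4 and the potential-
theoretic core of G2 in the road recorded in `Sweep1Proofs.lean`, module docstring §2b) of the
discharge programme for crit-ising.S18 / Smirnov's Theorem 2.2. Smirnov 2010, Lemma 5.3 (the
`L²`-bound `δ ∑ |F_δ|² ≤ C` on compacts, from which precompactness of `F_δ/√δ` follows) is
proved in the paper from the subharmonicity of `H` by the discrete Riesz representation and a
Green-function gradient bound (Lemma B.4). The tree's road replaces that by the following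
elementary potential theory on `ℤ²` (nearest-neighbour Laplacian of `LatticeLaplacian.lean`,
interior gradient estimate of `BoxDirichlet.lean`); everything is proved and `[folklore]`.

* `latticeBall c R` (closed sup-norm boxes as `Finset`s), `sum_add_eq_sum` (translating finite
  sums of functions supported well inside), `sum_mul_latticeLaplacian_comm` (**summation by
  parts** `∑ ψ Δs = ∑ s Δψ`), `sum_sq_sub_eq_neg_two_mul_sum` (**Dirichlet energy identity**
  `∑_x ∑_k (u(x+e_k) - u(x))² = -2 ∑ u Δu` for finitely supported `u`).
* The trapezoidal cutoff `trap`, `cutoff` (`= 1` on the ball of radius `L`, `0` off radius `2L`)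
  with `∑ |Δ cutoff| ≤ 80` (`sum_abs_latticeLaplacian_cutoff_le`), whence the **Laplacian mass
  bound** `∑_{ball L} Δs ≤ 80` for `s` subharmonic on the ball of radius `2L` with values in
  `[0, 1]` (`sum_latticeLaplacian_le`).
* The `L¹` gradient bound built on these (`sum_abs_sub_le_of_subharmonic_le_superharmonic`) is
  in the continuation file `SubharmonicGradientBound.lean`.

## References

* S. Smirnov, Ann. of Math. 172 (2010) 1435–1467, Lemma 5.3 and Appendix B — bib key `Smirnov2010`.
* G. F. Lawler, V. Limic, *Random Walk: A Modern Introduction*, CUP 2010, §6 (classical discrete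
  potential theory).
-/

noncomputable section

namespace Literature.Probability.LatticeModels

open Finset Real

/-! ### Lattice balls (closed boxes) as finite sets -/

/-- The closed lattice box `{x : |x_i - c_i| ≤ R}` of (sup-norm) radius `R` about `c`. [folklore] -/
def latticeBall (c : Site 2) (R : ℤ) : Finset (Site 2) :=
  Fintype.piFinset fun i => Finset.Icc (c i - R) (c i + R)

/-- Membership in a lattice ball. [folklore] -/
theorem mem_latticeBall {c : Site 2} {R : ℤ} {x : Site 2} :
    x ∈ latticeBall c R ↔ ∀ i, c i - R ≤ x i ∧ x i ≤ c i + R := by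
  simp [latticeBall, Fintype.mem_piFinset]

/-- Neighbours of points of the ball of radius `R` lie in the ball of radius `R + 1`. [folklore] -/
theorem add_cornerUnit_mem_latticeBall {c : Site 2} {R : ℤ} {x : Site 2} (hx : x ∈ latticeBall c R)
    (k : Fin 4) : x + cornerUnit k ∈ latticeBall c (R + 1) := by
  rw [mem_latticeBall] at hx ⊢
  intro i
  have h0 := hx 0
  have h1 := hx 1
  fin_cases i <;> fin_cases k <;> simp [cornerUnit] <;> constructor <;> linarith

/-- Monotonicity of lattice balls in the radius. [folklore] -/
theorem latticeBall_subset {c : Site 2} {R R' : ℤ} (h : R ≤ R') : latticeBall c R ⊆ latticeBall c R' := by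
  intro x hx
  rw [mem_latticeBall] at hx ⊢
  intro i; have := hx i; constructor <;> linarith

/-! ### Translation of finite sums and summation by parts -/

/-- **Translating a finite sum.** If `f` vanishes outside `B` and outside `B + v`, then
`∑_{x ∈ B} f (x + v) = ∑_{x ∈ B} f x`. [folklore] -/
theorem sum_add_eq_sum {f : Site 2 → ℝ} {B : Finset (Site 2)} (v : Site 2)
    (hf : ∀ x, f x ≠ 0 → x ∈ B ∧ x - v ∈ B) : ∑ x ∈ B, f (x + v) = ∑ x ∈ B, f x := by
  refine Finset.sum_bij_ne_zero (fun a _ _ => a + v) (fun a _ ha => (hf (a + v) ha).1)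
    (fun a _ _ b _ _ h => add_right_cancel h) (fun b hb hfb => ?_) (fun a _ _ => rfl)
  exact ⟨b - v, (hf b hfb).2, by simpa using hfb, sub_add_cancel b v⟩

/-- **Summation by parts on `ℤ²`.** If `ψ` and all its lattice neighbours' preimages lie in `B`
(precisely: `ψ x ≠ 0` forces `x ∈ B` and `x + e_k ∈ B` for all `k`), then
`∑_{x ∈ B} ψ x · Δ s (x) = ∑_{x ∈ B} s x · Δ ψ (x)`. [folklore] -/
theorem sum_mul_latticeLaplacian_comm {ψ s : Site 2 → ℝ} {B : Finset (Site 2)}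
    (hψ : ∀ x, ψ x ≠ 0 → x ∈ B ∧ ∀ k : Fin 4, x + cornerUnit k ∈ B) :
    ∑ x ∈ B, ψ x * latticeLaplacian s x = ∑ x ∈ B, s x * latticeLaplacian ψ x := by
  -- `∑_x ψ(x) s(x + e_k) = ∑_y ψ(y - e_k) s(y)`
  have hk : ∀ k : Fin 4, ∑ x ∈ B, ψ x * s (x + cornerUnit k) = ∑ y ∈ B, ψ (y - cornerUnit k) * s y := by
    intro k
    have := sum_add_eq_sum (B := B) (f := fun y => ψ (y - cornerUnit k) * s y) (cornerUnit k) (fun y hy => ?_)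
    · simpa using this
    · have hψy : ψ (y - cornerUnit k) ≠ 0 := fun h => hy (by simp [h])
      obtain ⟨h1, h2⟩ := hψ _ hψy
      have := h2 k
      rw [sub_add_cancel] at this
      exact ⟨this, h1⟩
  calc ∑ x ∈ B, ψ x * latticeLaplacian s x
      = ∑ x ∈ B, ((∑ k : Fin 4, ψ x * s (x + cornerUnit k)) - 4 * (ψ x * s x)) := by
        refine Finset.sum_congr rfl fun x _ => ?_
        rw [latticeLaplacian_eq, mul_sub, Finset.mul_sum]; ring
    _ = (∑ k : Fin 4, ∑ x ∈ B, ψ x * s (x + cornerUnit k)) - 4 * ∑ x ∈ B, ψ x * s x := by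
        rw [Finset.sum_sub_distrib, Finset.sum_comm, Finset.mul_sum]
    _ = (∑ k : Fin 4, ∑ y ∈ B, ψ (y - cornerUnit k) * s y) - 4 * ∑ x ∈ B, ψ x * s x := by
        rw [Finset.sum_congr rfl fun k _ => hk k]
    _ = (∑ k : Fin 4, ∑ y ∈ B, ψ (y + cornerUnit k) * s y) - 4 * ∑ x ∈ B, ψ x * s x := by
        congr 1
        rw [← Equiv.sum_comp (Equiv.addRight (2 : Fin 4))]
        refine Finset.sum_congr rfl fun k _ => Finset.sum_congr rfl fun y _ => ?_
        simp only [Equiv.coe_addRight, cornerUnit_add_two, sub_eq_add_neg, neg_neg]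
    _ = ∑ y ∈ B, s y * latticeLaplacian ψ y := by
        rw [Finset.sum_comm, Finset.mul_sum, ← Finset.sum_sub_distrib]
        refine Finset.sum_congr rfl fun y _ => ?_
        rw [latticeLaplacian_eq, mul_sub, Finset.mul_sum]
        congr 1
        · exact Finset.sum_congr rfl fun k _ => mul_comm _ _
        · ring

/-- **The Dirichlet energy identity.** If `u x ≠ 0` forces `x ∈ B` and `x + e_k ∈ B` for all `k`,
then `∑_{x ∈ B} ∑_k (u(x + e_k) - u(x))² = -2 ∑_{x ∈ B} u(x) Δu(x)` (each lattice edge being counted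
from both ends). [folklore] -/
theorem sum_sq_sub_eq_neg_two_mul_sum {u : Site 2 → ℝ} {B : Finset (Site 2)}
    (hu : ∀ x, u x ≠ 0 → x ∈ B ∧ ∀ k : Fin 4, x + cornerUnit k ∈ B) :
    ∑ x ∈ B, ∑ k : Fin 4, (u (x + cornerUnit k) - u x) ^ 2 =
      -2 * ∑ x ∈ B, u x * latticeLaplacian u x := by
  -- `A_k = ∑_x u(x) (u(x) - u(x + e_k))`
  set A : Fin 4 → ℝ := fun k => ∑ x ∈ B, u x * (u x - u (x + cornerUnit k)) with hA
  have hrhs : -2 * ∑ x ∈ B, u x * latticeLaplacian u x = 2 * ∑ k : Fin 4, A k := by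
    rw [hA]
    simp only
    rw [Finset.sum_comm, Finset.mul_sum, Finset.mul_sum]
    refine Finset.sum_congr rfl fun x _ => ?_
    simp only [latticeLaplacian, Finset.mul_sum]
    refine Finset.sum_congr rfl fun k _ => ?_
    ring
  -- the other half: `∑_x u(x + e_k)(u(x + e_k) - u(x)) = A_{k+2}`
  have hhalf : ∀ k : Fin 4, ∑ x ∈ B, u (x + cornerUnit k) * (u (x + cornerUnit k) - u x) = A (k + 2) := by
    intro k
    have := sum_add_eq_sum (B := B) (f := fun y => u y * (u y - u (y - cornerUnit k))) (cornerUnit k) (fun y hy => ?_)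
    · simp only [add_sub_cancel_right] at this
      rw [this, hA]
      refine Finset.sum_congr rfl fun y _ => ?_
      simp only [cornerUnit_add_two, sub_eq_add_neg]
    · have huy : u y ≠ 0 := fun h => hy (by simp [h])
      obtain ⟨h1, h2⟩ := hu _ huy
      refine ⟨h1, ?_⟩
      have := h2 (k + 2)
      rwa [cornerUnit_add_two, ← sub_eq_add_neg] at this
  rw [hrhs]
  calc ∑ x ∈ B, ∑ k : Fin 4, (u (x + cornerUnit k) - u x) ^ 2
      = ∑ k : Fin 4, ((∑ x ∈ B, u (x + cornerUnit k) * (u (x + cornerUnit k) - u x)) + A k) := by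
        rw [Finset.sum_comm]
        refine Finset.sum_congr rfl fun k _ => ?_
        rw [hA, ← Finset.sum_add_distrib]
        refine Finset.sum_congr rfl fun x _ => ?_
        ring
    _ = ∑ k : Fin 4, (A (k + 2) + A k) := by rw [Finset.sum_congr rfl fun k _ => by rw [hhalf k]]
    _ = (∑ k : Fin 4, A (k + 2)) + ∑ k : Fin 4, A k := Finset.sum_add_distrib
    _ = 2 * ∑ k : Fin 4, A k := by
        have e := Equiv.sum_comp (Equiv.addRight (2 : Fin 4)) A
        simp only [Equiv.coe_addRight] at e
        rw [e]; ring

/-! ### The trapezoidal cutoff -/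

/-- The **trapezoid** `trap L t = clamp((2L - |t|)/L ; 0, 1)`: equal to `1` for `|t| ≤ L`, to `0` for
`|t| ≥ 2L`, linear in between. [folklore] -/
def trap (L : ℕ) (t : ℤ) : ℝ := max 0 (min 1 ((2 * L - |(t : ℝ)|) / L))

variable {L : ℕ}

/-- `0 ≤ trap ≤ 1`. [folklore] -/
theorem trap_nonneg (L : ℕ) (t : ℤ) : 0 ≤ trap L t := le_max_left _ _

/-- `trap ≤ 1`. [folklore] -/
theorem trap_le_one (L : ℕ) (t : ℤ) : trap L t ≤ 1 :=
  max_le zero_le_one (min_le_left _ _)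

/-- `trap = 1` on `|t| ≤ L`. [folklore] -/
theorem trap_eq_one (hL : 0 < L) {t : ℤ} (ht : |t| ≤ L) : trap L t = 1 := by
  unfold trap
  have hLr : (0 : ℝ) < L := by exact_mod_cast hL
  have h1 : (1 : ℝ) ≤ (2 * L - |(t : ℝ)|) / L := by
    rw [le_div_iff₀ hLr]
    have : |(t : ℝ)| ≤ L := by exact_mod_cast ht
    linarith
  rw [min_eq_left h1, max_eq_right zero_le_one]

/-- `trap = 0` on `|t| ≥ 2L`. [folklore] -/
theorem trap_eq_zero (hL : 0 < L) {t : ℤ} (ht : 2 * (L : ℤ) ≤ |t|) : trap L t = 0 := by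
  unfold trap
  have hLr : (0 : ℝ) < L := by exact_mod_cast hL
  have h1 : (2 * L - |(t : ℝ)|) / L ≤ 0 := by
    apply div_nonpos_of_nonpos_of_nonneg _ hLr.le
    have : (2 * L : ℝ) ≤ |(t : ℝ)| := by exact_mod_cast ht
    linarith
  rw [max_eq_left]
  exact (min_le_right _ _).trans h1

/-- `trap = (2L - |t|)/L` on `L ≤ |t| ≤ 2L`. [folklore] -/
theorem trap_eq_of_mem (hL : 0 < L) {t : ℤ} (h1 : (L : ℤ) ≤ |t|) (h2 : |t| ≤ 2 * (L : ℤ)) :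
    trap L t = (2 * L - |(t : ℝ)|) / L := by
  unfold trap
  have hLr : (0 : ℝ) < L := by exact_mod_cast hL
  have ha : 0 ≤ (2 * L - |(t : ℝ)|) / L := by
    apply div_nonneg _ hLr.le
    have : |(t : ℝ)| ≤ 2 * L := by exact_mod_cast h2
    linarith
  have hb : (2 * L - |(t : ℝ)|) / L ≤ 1 := by
    rw [div_le_one hLr]
    have : (L : ℝ) ≤ |(t : ℝ)| := by exact_mod_cast h1
    linarith
  rw [min_eq_right hb, max_eq_right ha]

/-- The trapezoid is `(1/L)`-Lipschitz. [folklore] -/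
theorem abs_trap_sub_trap_le (hL : 0 < L) (t t' : ℤ) : |trap L t - trap L t'| ≤ |(t : ℝ) - t'| / L := by
  unfold trap
  have hLr : (0 : ℝ) < L := by exact_mod_cast hL
  refine (abs_max_sub_max_le_max _ _ _ _).trans ?_
  rw [sub_self, abs_zero, max_eq_right (abs_nonneg _)]
  refine (abs_min_sub_min_le_max _ _ _ _).trans ?_
  rw [sub_self, abs_zero, max_eq_right (abs_nonneg _), ← sub_div, abs_div, abs_of_pos hLr]
  refine div_le_div_of_nonneg_right ?_ hLr.le
  rw [show (2 * L - |(t : ℝ)|) - (2 * L - |(t' : ℝ)|) = |(t' : ℝ)| - |(t : ℝ)| by ring]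
  rw [abs_sub_comm ((t : ℝ)) t']
  exact abs_abs_sub_abs_le_abs_sub _ _

/-- The second difference `trap(t+1) + trap(t-1) - 2 trap(t)`. [folklore] -/
def trapD2 (L : ℕ) (t : ℤ) : ℝ := trap L (t + 1) + trap L (t - 1) - 2 * trap L t

/-- `|trapD2| ≤ 2/L`. [folklore] -/
theorem abs_trapD2_le (hL : 0 < L) (t : ℤ) : |trapD2 L t| ≤ 2 / L := by
  unfold trapD2
  have h1 := abs_trap_sub_trap_le hL (t + 1) t
  have h2 := abs_trap_sub_trap_le hL (t - 1) t
  push_cast at h1 h2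
  rw [show (t : ℝ) + 1 - t = 1 by ring, abs_one] at h1
  rw [show (t : ℝ) - 1 - t = -1 by ring, abs_neg, abs_one] at h2
  rw [show trap L (t + 1) + trap L (t - 1) - 2 * trap L t = (trap L (t + 1) - trap L t) + (trap L (t - 1) - trap L t) by ring]
  refine (abs_add_le _ _).trans ?_
  rw [show (2 : ℝ) / L = 1 / L + 1 / L by ring]
  exact add_le_add h1 h2

/-- The second difference vanishes away from the four kinks `±L, ±2L` (`L ≥ 1`). [folklore] -/
theorem trapD2_eq_zero (hL : 0 < L) {t : ℤ} (h1 : |t| ≠ L) (h2 : |t| ≠ 2 * (L : ℤ)) : trapD2 L t = 0 := by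
  unfold trapD2
  rcases lt_or_gt_of_ne h1 with hlt | hgt
  · -- flat top: all three values are `1`
    rw [trap_eq_one hL (t := t + 1) (by rw [abs_le]; rw [abs_lt] at hlt; omega),
      trap_eq_one hL (t := t - 1) (by rw [abs_le]; rw [abs_lt] at hlt; omega), trap_eq_one hL hlt.le]
    ring
  rcases lt_or_gt_of_ne h2 with hlt2 | hgt2
  · -- linear piece: `L < |t| < 2L`, so `t - 1, t, t + 1` have the same sign
    rcases lt_or_ge t 0 with hneg | hpos
    · rw [abs_of_neg hneg] at hgt hlt2
      rw [trap_eq_of_mem hL (t := t + 1) (by rw [abs_of_neg (by omega)]; omega) (by rw [abs_of_neg (by omega)]; omega),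
        trap_eq_of_mem hL (t := t - 1) (by rw [abs_of_neg (by omega)]; omega) (by rw [abs_of_neg (by omega)]; omega),
        trap_eq_of_mem hL (t := t) (by rw [abs_of_neg hneg]; omega) (by rw [abs_of_neg hneg]; omega)]
      have ht1 : ((t : ℝ)) + 1 < 0 := by exact_mod_cast (show t + 1 < 0 by omega)
      have ht2 : (t : ℝ) - 1 < 0 := by exact_mod_cast (show t - 1 < 0 by omega)
      have ht0 : (t : ℝ) < 0 := by exact_mod_cast hneg
      push_cast
      rw [abs_of_neg ht1, abs_of_neg ht2, abs_of_neg ht0]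
      field_simp; ring
    · rw [abs_of_nonneg hpos] at hgt hlt2
      rw [trap_eq_of_mem hL (t := t + 1) (by rw [abs_of_nonneg (by omega)]; omega) (by rw [abs_of_nonneg (by omega)]; omega),
        trap_eq_of_mem hL (t := t - 1) (by rw [abs_of_nonneg (by omega)]; omega) (by rw [abs_of_nonneg (by omega)]; omega),
        trap_eq_of_mem hL (t := t) (by rw [abs_of_nonneg hpos]; omega) (by rw [abs_of_nonneg hpos]; omega)]
      have ht1 : (0 : ℝ) ≤ (t : ℝ) + 1 := by exact_mod_cast (show 0 ≤ t + 1 by omega)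
      have ht2 : (0 : ℝ) ≤ (t : ℝ) - 1 := by exact_mod_cast (show 0 ≤ t - 1 by omega)
      have ht0 : (0 : ℝ) ≤ (t : ℝ) := by exact_mod_cast hpos
      push_cast
      rw [abs_of_nonneg ht1, abs_of_nonneg ht2, abs_of_nonneg ht0]
      field_simp; ring
  · -- beyond the support: all three values are `0`
    rw [trap_eq_zero hL (t := t + 1) (by rw [le_abs]; rw [lt_abs] at hgt2; omega),
      trap_eq_zero hL (t := t - 1) (by rw [le_abs]; rw [lt_abs] at hgt2; omega), trap_eq_zero hL hgt2.le]
    ring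

/-- `∑_{t ∈ T} trap L t ≤ 4L + 1` for every finite set of integers `T`. [folklore] -/
theorem sum_trap_le (hL : 0 < L) (T : Finset ℤ) : ∑ t ∈ T, trap L t ≤ 4 * L + 1 := by
  classical
  have hsupp : ∀ t ∈ T, t ∉ Finset.Icc (-(2 * (L : ℤ))) (2 * L) → trap L t = 0 := by
    intro t _ ht
    rw [Finset.mem_Icc, not_and_or, not_le, not_le] at ht
    apply trap_eq_zero hL
    rcases ht with h | h
    · rw [abs_of_neg (by omega)]; omega
    · rw [abs_of_nonneg (by omega)]; omega
  calc ∑ t ∈ T, trap L t = ∑ t ∈ T ∩ Finset.Icc (-(2 * (L : ℤ))) (2 * L), trap L t := by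
        refine (Finset.sum_subset Finset.inter_subset_left fun t ht hnot => hsupp t ht fun hK => ?_).symm
        exact hnot (Finset.mem_inter.2 ⟨ht, hK⟩)
    _ ≤ ∑ t ∈ T ∩ Finset.Icc (-(2 * (L : ℤ))) (2 * L), (1 : ℝ) := Finset.sum_le_sum fun t _ => trap_le_one L t
    _ = ((T ∩ Finset.Icc (-(2 * (L : ℤ))) (2 * L)).card : ℝ) := by simp
    _ ≤ ((Finset.Icc (-(2 * (L : ℤ))) (2 * L)).card : ℝ) := by
        exact_mod_cast Finset.card_le_card Finset.inter_subset_right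
    _ = 4 * L + 1 := by
        rw [Int.card_Icc]
        have e : ((2 * (L : ℤ)) + 1 - -(2 * (L : ℤ))).toNat = 4 * L + 1 := by omega
        rw [e]; push_cast; ring

/-- `∑_{t ∈ T} |trapD2 L t| ≤ 8/L` for every finite set of integers `T`. [folklore] -/
theorem sum_abs_trapD2_le (hL : 0 < L) (T : Finset ℤ) : ∑ t ∈ T, |trapD2 L t| ≤ 8 / L := by
  classical
  set K : Finset ℤ := {(L : ℤ), -(L : ℤ), 2 * (L : ℤ), -(2 * (L : ℤ))} with hK
  have hsupp : ∀ t ∈ T, t ∉ K → |trapD2 L t| = 0 := by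
    intro t _ ht
    rw [hK] at ht
    simp only [Finset.mem_insert, Finset.mem_singleton, not_or] at ht
    rw [trapD2_eq_zero hL, abs_zero]
    · intro h; rcases abs_eq_abs.1 (h.trans (abs_of_nonneg (by positivity)).symm) with h' | h' <;> omega
    · intro h; rcases abs_eq_abs.1 (h.trans (abs_of_nonneg (by positivity)).symm) with h' | h' <;> omega
  have hLr : (0 : ℝ) < L := by exact_mod_cast hL
  calc ∑ t ∈ T, |trapD2 L t| = ∑ t ∈ T ∩ K, |trapD2 L t| := by
        refine (Finset.sum_subset Finset.inter_subset_left fun t ht hnot => hsupp t ht fun hK => ?_).symm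
        exact hnot (Finset.mem_inter.2 ⟨ht, hK⟩)
    _ ≤ ∑ t ∈ T ∩ K, (2 : ℝ) / L := Finset.sum_le_sum fun t _ => abs_trapD2_le hL t
    _ = ((T ∩ K).card : ℝ) * (2 / L) := by simp
    _ ≤ 4 * (2 / L) := by
        refine mul_le_mul_of_nonneg_right ?_ (by positivity)
        have h1 : ((T ∩ K).card : ℝ) ≤ K.card := by exact_mod_cast Finset.card_le_card Finset.inter_subset_right
        have h2 : (K.card : ℝ) ≤ 4 := by
          rw [hK]; exact_mod_cast (Finset.card_le_four)
        linarith
    _ = 8 / L := by ring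

/-! ### The two-dimensional cutoff and its Laplacian -/

/-- The cutoff `ψ(x) = trap(x₀ - c₀) trap(x₁ - c₁)`: `1` on the ball of radius `L` about `c`, `0` off
the ball of radius `2L`, values in `[0, 1]`. [folklore] -/
def cutoff (c : Site 2) (L : ℕ) (x : Site 2) : ℝ := trap L (x 0 - c 0) * trap L (x 1 - c 1)

/-- `ψ ≥ 0`. [folklore] -/
theorem cutoff_nonneg (c : Site 2) (L : ℕ) (x : Site 2) : 0 ≤ cutoff c L x :=
  mul_nonneg (trap_nonneg _ _) (trap_nonneg _ _)

/-- `ψ = 1` on the ball of radius `L`. [folklore] -/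
theorem cutoff_eq_one (hL : 0 < L) {c x : Site 2} (hx : x ∈ latticeBall c L) : cutoff c L x = 1 := by
  rw [mem_latticeBall] at hx
  unfold cutoff
  rw [trap_eq_one hL (by rw [abs_le]; have := hx 0; omega), trap_eq_one hL (by rw [abs_le]; have := hx 1; omega), mul_one]

/-- `ψ` is supported on the ball of radius `2L`. [folklore] -/
theorem mem_latticeBall_of_cutoff_ne_zero (hL : 0 < L) {c x : Site 2} (hx : cutoff c L x ≠ 0) :
    x ∈ latticeBall c (2 * L) := by
  rw [mem_latticeBall]
  unfold cutoff at hx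
  have h0 : trap L (x 0 - c 0) ≠ 0 := left_ne_zero_of_mul hx
  have h1 : trap L (x 1 - c 1) ≠ 0 := right_ne_zero_of_mul hx
  have k0 : |x 0 - c 0| < 2 * (L : ℤ) := by
    by_contra h; exact h0 (trap_eq_zero hL (not_lt.1 h))
  have k1 : |x 1 - c 1| < 2 * (L : ℤ) := by
    by_contra h; exact h1 (trap_eq_zero hL (not_lt.1 h))
  rw [abs_lt] at k0 k1
  intro i; fin_cases i <;> simp <;> omega

/-- The Laplacian of the product cutoff. [folklore] -/
theorem latticeLaplacian_cutoff (c : Site 2) (L : ℕ) (x : Site 2) :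
    latticeLaplacian (cutoff c L) x =
      trapD2 L (x 0 - c 0) * trap L (x 1 - c 1) + trap L (x 0 - c 0) * trapD2 L (x 1 - c 1) := by
  have h := latticeLaplacian_coord (fun i j => trap L (i - c 0) * trap L (j - c 1)) x
  have e : cutoff c L = fun y => (fun i j => trap L (i - c 0) * trap L (j - c 1)) (y 0) (y 1) := rfl
  rw [e, h]
  simp only [trapD2]
  rw [show x 0 + 1 - c 0 = x 0 - c 0 + 1 by ring, show x 0 - 1 - c 0 = x 0 - c 0 - 1 by ring,
    show x 1 + 1 - c 1 = x 1 - c 1 + 1 by ring, show x 1 - 1 - c 1 = x 1 - c 1 - 1 by ring]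
  ring

/-- Product sums over lattice balls factor. [folklore] -/
theorem sum_latticeBall_mul (c : Site 2) (R : ℤ) (g h : ℤ → ℝ) :
    ∑ x ∈ latticeBall c R, g (x 0) * h (x 1) =
      (∑ i ∈ Finset.Icc (c 0 - R) (c 0 + R), g i) * ∑ j ∈ Finset.Icc (c 1 - R) (c 1 + R), h j := by
  have := Finset.prod_univ_sum (fun i : Fin 2 => Finset.Icc (c i - R) (c i + R)) ![g, h]
  rw [Fin.prod_univ_two] at this
  simp only [Matrix.cons_val_zero, Matrix.cons_val_one] at this
  rw [latticeBall, this]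
  refine Finset.sum_congr rfl fun x _ => ?_
  rw [Fin.prod_univ_two]
  simp

/-- Shifting a sum over an integer interval. [folklore] -/
theorem sum_Icc_sub_eq (a R : ℤ) (g : ℤ → ℝ) :
    ∑ i ∈ Finset.Icc (a - R) (a + R), g (i - a) = ∑ t ∈ Finset.Icc (-R) R, g t := by
  refine Finset.sum_nbij' (fun i => i - a) (fun t => t + a) (fun i hi => ?_) (fun t ht => ?_)
    (fun i _ => by ring) (fun t _ => by ring) (fun i _ => rfl)
  · rw [Finset.mem_Icc] at hi ⊢; omega
  · rw [Finset.mem_Icc] at ht ⊢; omega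

/-- **`∑ |Δψ| ≤ 80`** over any lattice ball about `c` (`L ≥ 1`). [folklore] -/
theorem sum_abs_latticeLaplacian_cutoff_le (hL : 0 < L) (c : Site 2) (R : ℤ) :
    ∑ x ∈ latticeBall c R, |latticeLaplacian (cutoff c L) x| ≤ 80 := by
  have hLr : (0 : ℝ) < L := by exact_mod_cast hL
  have hA := sum_abs_trapD2_le hL (Finset.Icc (-R) R)
  have hB := sum_trap_le hL (Finset.Icc (-R) R)
  have hA0 : 0 ≤ ∑ t ∈ Finset.Icc (-R) R, |trapD2 L t| := Finset.sum_nonneg fun t _ => abs_nonneg _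
  have hB0 : 0 ≤ ∑ t ∈ Finset.Icc (-R) R, trap L t := Finset.sum_nonneg fun t _ => trap_nonneg _ _
  calc ∑ x ∈ latticeBall c R, |latticeLaplacian (cutoff c L) x|
      ≤ ∑ x ∈ latticeBall c R, (|trapD2 L (x 0 - c 0)| * trap L (x 1 - c 1) + trap L (x 0 - c 0) * |trapD2 L (x 1 - c 1)|) := by
        refine Finset.sum_le_sum fun x _ => ?_
        rw [latticeLaplacian_cutoff]
        refine (abs_add_le _ _).trans ?_
        rw [abs_mul, abs_mul, abs_of_nonneg (trap_nonneg L (x 1 - c 1)), abs_of_nonneg (trap_nonneg L (x 0 - c 0))]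
    _ = (∑ t ∈ Finset.Icc (-R) R, |trapD2 L t|) * (∑ t ∈ Finset.Icc (-R) R, trap L t) +
          (∑ t ∈ Finset.Icc (-R) R, trap L t) * (∑ t ∈ Finset.Icc (-R) R, |trapD2 L t|) := by
        have hA1 : ∑ i ∈ Finset.Icc (c 0 - R) (c 0 + R), |trapD2 L (i - c 0)| = ∑ t ∈ Finset.Icc (-R) R, |trapD2 L t| :=
          sum_Icc_sub_eq (c 0) R (fun t => |trapD2 L t|)
        have hA2 : ∑ j ∈ Finset.Icc (c 1 - R) (c 1 + R), |trapD2 L (j - c 1)| = ∑ t ∈ Finset.Icc (-R) R, |trapD2 L t| :=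
          sum_Icc_sub_eq (c 1) R (fun t => |trapD2 L t|)
        have hB1 : ∑ i ∈ Finset.Icc (c 0 - R) (c 0 + R), trap L (i - c 0) = ∑ t ∈ Finset.Icc (-R) R, trap L t :=
          sum_Icc_sub_eq (c 0) R (fun t => trap L t)
        have hB2 : ∑ j ∈ Finset.Icc (c 1 - R) (c 1 + R), trap L (j - c 1) = ∑ t ∈ Finset.Icc (-R) R, trap L t :=
          sum_Icc_sub_eq (c 1) R (fun t => trap L t)
        rw [Finset.sum_add_distrib,
          sum_latticeBall_mul c R (fun i => |trapD2 L (i - c 0)|) (fun j => trap L (j - c 1)),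
          sum_latticeBall_mul c R (fun i => trap L (i - c 0)) (fun j => |trapD2 L (j - c 1)|),
          hA1, hA2, hB1, hB2]
    _ ≤ 8 / L * (4 * L + 1) + (4 * L + 1) * (8 / L) := by
        gcongr
    _ = 16 * (4 * L + 1) / L := by field_simp; ring
    _ ≤ 80 := by
        rw [div_le_iff₀ hLr]
        have : (1 : ℝ) ≤ L := by exact_mod_cast hL
        nlinarith

/-! ### The Laplacian mass of a bounded subharmonic function -/

/-- **`∑_{ball of radius L} Δs ≤ 80`** for a function `s` subharmonic on the ball of radius `2L`
about `c` and with values in `[0, 1]` on the ball of radius `2L + 1` (`L ≥ 1`): summation by parts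
against the cutoff `ψ`, `∑ ψ Δs = ∑ s Δψ ≤ ∑ |Δψ| ≤ 80`. [folklore] -/
theorem sum_latticeLaplacian_le (hL : 0 < L) {c : Site 2} {s : Site 2 → ℝ}
    (hsub : IsLatticeSubharmonicOn s (latticeBall c (2 * L) : Set (Site 2)))
    (hs : ∀ x ∈ latticeBall c (2 * L + 1), 0 ≤ s x ∧ s x ≤ 1) :
    ∑ x ∈ latticeBall c L, latticeLaplacian s x ≤ 80 := by
  set B := latticeBall c (2 * L + 1) with hBdef
  have hsub' : ∀ x, cutoff c L x ≠ 0 → 0 ≤ latticeLaplacian s x := fun x hx =>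
    hsub x (mem_latticeBall_of_cutoff_ne_zero hL hx)
  have hsupp : ∀ x, cutoff c L x ≠ 0 → x ∈ B ∧ ∀ k : Fin 4, x + cornerUnit k ∈ B := by
    intro x hx
    have hx2 := mem_latticeBall_of_cutoff_ne_zero hL hx
    exact ⟨latticeBall_subset (by omega) hx2, fun k => add_cornerUnit_mem_latticeBall hx2 k⟩
  calc ∑ x ∈ latticeBall c L, latticeLaplacian s x
      = ∑ x ∈ latticeBall c L, cutoff c L x * latticeLaplacian s x := by
        refine Finset.sum_congr rfl fun x hx => ?_
        rw [cutoff_eq_one hL hx, one_mul]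
    _ ≤ ∑ x ∈ B, cutoff c L x * latticeLaplacian s x := by
        refine Finset.sum_le_sum_of_subset_of_nonneg (latticeBall_subset (by omega)) fun x _ _ => ?_
        by_cases h : cutoff c L x = 0
        · rw [h, zero_mul]
        · exact mul_nonneg (cutoff_nonneg c L x) (hsub' x h)
    _ = ∑ x ∈ B, s x * latticeLaplacian (cutoff c L) x := sum_mul_latticeLaplacian_comm hsupp
    _ ≤ ∑ x ∈ B, |latticeLaplacian (cutoff c L) x| := by
        refine Finset.sum_le_sum fun x hx => ?_
        obtain ⟨h0, h1⟩ := hs x hx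
        calc s x * latticeLaplacian (cutoff c L) x ≤ |s x * latticeLaplacian (cutoff c L) x| := le_abs_self _
          _ = |s x| * |latticeLaplacian (cutoff c L) x| := abs_mul _ _
          _ ≤ 1 * |latticeLaplacian (cutoff c L) x| := by
              refine mul_le_mul_of_nonneg_right ?_ (abs_nonneg _)
              rw [abs_of_nonneg h0]; exact h1
          _ = _ := one_mul _
    _ ≤ 80 := sum_abs_latticeLaplacian_cutoff_le hL c (2 * L + 1)


end Literature.Probability.LatticeModels
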